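import Mathlib
import Summits.CriticalPhenomena.CardyFormulaZ2.Theorems.CardyWhiteToColouredDriftBoundPlackettDefs
import Summits.CriticalPhenomena.CardyFormulaZ2.Theorems.CardyWhiteToColouredDriftBoundPlackettVar
import Summits.CriticalPhenomena.CardyFormulaZ2.Theorems.CardyWhiteToColouredDriftBoundPlackettNormWeight

/-!
# The Plackett/Piterbarg drift of line `registered` is a pure PAIR functional: the diagonal coefficients vanish

Helper file for the crux item `stmt-CriticalPhenomena-4596`
(`Summit.CriticalPhenomena.CardyFormulaZ2.Theses.CardyWhiteToColoured.DriftBound`, route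
`CardyWhiteToColoured` of `CardyFormulaZ2`), line `registered` (skeleton v4.1, lead c3), about the one
open stub `stub_pairEstimate` (the pair estimate on `plackettDrift`). The variance normalisation of the
field makes `∑_e normWeight σ x e ² ≡ 1` for `σ > 0`, so its `σ`-derivative — twice the diagonal
Plackett coefficient `plackettCoeff σ x x = ∑' e, ∂_σ(normWeight σ x e) · normWeight σ x e` — vanishes:
the exact drift `plackettDrift I A η σ = ∑_{i,j} plackettCoeff σ (m i) (m j) E[∂_j∂_iΦ_η(X̃^σ)]` has NO
diagonal (single-edge pivotal) terms and is a sum over PAIRS `i ≠ j` only (`plackettDrift_eq_offDiag`).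
This is the structural fact behind the "pivotal pairs" reading of Beliaev–Muirhead–Rivera 2020,
Thm 2.14 (there obtained by normalising the field to unit variance), and the reason the open estimate
is a statement about pair (4-arm-type) intensities.

References: D. Beliaev, S. Muirhead, A. Rivera, Ann. Probab. 48 (2020), §2.2, Thm 2.14; R. L. Plackett,
Biometrika 41 (1954).
-/

noncomputable section

namespace Summit.CriticalPhenomena.CardyFormulaZ2.Cruxes.DriftBound.Birth

open Set Filter Topology MeasureTheory
open Literature.Probability.LatticeModels Literature.Probability.Percolation

/-- **Unit variance**: for `σ > 0`, `∑' e, normWeight σ x e ² = 1`. -/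
theorem pg_tsum_normWeight_sq {σ : ℝ} (hσ : 0 < σ) (x : ℂ) :
    ∑' e : (zdGraph 2).edgeSet, normWeight σ x e ^ 2 = 1 := by
  have hv : 0 < noiseVar σ x := pl_noiseVar_pos' hσ x
  have hsq : Real.sqrt (noiseVar σ x) ^ 2 = noiseVar σ x := Real.sq_sqrt hv.le
  have hterm : ∀ e : (zdGraph 2).edgeSet,
      normWeight σ x e ^ 2 = gaussWeight σ (x - medialPoint 1 e.1) ^ 2 / noiseVar σ x := by
    intro e
    rw [normWeight, div_pow, hsq]
  simp_rw [hterm]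
  rw [tsum_div_const]
  exact div_self hv.ne'

/-- The squares of the normalised kernels are termwise differentiable in `σ > 0` with derivative
`2 · ∂_σ(normWeight) · normWeight`. -/
theorem pg_hasDerivAt_normWeight_sq {σ : ℝ} (hσ : 0 < σ) (x : ℂ) (e : (zdGraph 2).edgeSet) :
    HasDerivAt (fun s : ℝ => normWeight s x e ^ 2)
      (2 * (deriv (fun s : ℝ => normWeight s x e) σ * normWeight σ x e)) σ := by
  have hd : HasDerivAt (fun s : ℝ => normWeight s x e) (deriv (fun s : ℝ => normWeight s x e) σ) σ :=
    ((pl_normWeight_family x σ σ hσ le_rfl).2.1 e σ hσ).hasDerivAt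
  have h := hd.mul hd
  have e1 : (fun s : ℝ => normWeight s x e ^ 2) = fun s => normWeight s x e * normWeight s x e := by
    funext s; ring
  rw [e1]
  refine h.congr_deriv ?_
  ring

/-- **The diagonal Plackett coefficient vanishes**: `plackettCoeff σ x x = 0` for `σ > 0`. Proof: on
the neighbourhood `(σ/2, 2σ)` the series `∑' e, normWeight s x e ²` is termwise differentiable with
the summable envelope of `pl_normWeight_family` (dominated termwise differentiation,
`hasDerivAt_tsum_of_isPreconnected`), so its derivative at `σ` is `2 · plackettCoeff σ x x`; but the
series is identically `1`, so the derivative is `0`. -/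
theorem pg_plackettCoeff_self {σ : ℝ} (hσ : 0 < σ) (x : ℂ) : plackettCoeff σ x x = 0 := by
  -- envelope on `[σ/2, 2σ]`
  have ha : 0 < σ / 2 := by positivity
  have hab : σ / 2 ≤ 2 * σ := by linarith
  obtain ⟨-, hdiff, -, u, hu, hdom⟩ := pl_normWeight_family x (σ / 2) (2 * σ) ha hab
  have hu0 : ∀ e, 0 ≤ u e := fun e => (abs_nonneg _).trans (hdom σ ⟨by linarith, by linarith⟩ e).1
  set U : ℝ := ∑' e, u e with hU
  have hUe : ∀ e, u e ≤ U := fun e => hu.le_tsum e (fun e' _ => hu0 e')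
  -- termwise differentiation of `∑' normWeight² ` on `Ioo (σ/2) (2σ)`
  have hmem : σ ∈ Ioo (σ / 2) (2 * σ) := ⟨by linarith, by linarith⟩
  have hderiv : HasDerivAt (fun s : ℝ => ∑' e : (zdGraph 2).edgeSet, normWeight s x e ^ 2)
      (∑' e : (zdGraph 2).edgeSet, 2 * (deriv (fun s : ℝ => normWeight s x e) σ * normWeight σ x e)) σ := by
    refine hasDerivAt_tsum_of_isPreconnected (u := fun e => 2 * (U * u e)) (hu.mul_left U |>.mul_left 2)
      isOpen_Ioo isPreconnected_Ioo (fun e s hs => pg_hasDerivAt_normWeight_sq (ha.trans hs.1) x e)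
      (fun e s hs => ?_) hmem ?_ hmem
    · have hs : s ∈ Icc (σ / 2) (2 * σ) := Ioo_subset_Icc_self hs
      obtain ⟨h1, h2⟩ := hdom s hs e
      rw [Real.norm_eq_abs, abs_mul, abs_mul, abs_two]
      refine mul_le_mul_of_nonneg_left ?_ zero_le_two
      calc |deriv (fun s : ℝ => normWeight s x e) s| * |normWeight s x e|
          ≤ u e * u e := mul_le_mul h2 h1 (abs_nonneg _) (hu0 e)
        _ ≤ U * u e := mul_le_mul_of_nonneg_right (hUe e) (hu0 e)
    · exact summable_of_sum_eq_one hσ x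
  -- the series is identically `1` near `σ`, so its derivative vanishes
  have hconst : HasDerivAt (fun s : ℝ => ∑' e : (zdGraph 2).edgeSet, normWeight s x e ^ 2) 0 σ := by
    refine (hasDerivAt_const σ (1 : ℝ)).congr_of_eventuallyEq ?_
    filter_upwards [Ioi_mem_nhds hσ] with s hs
    exact pg_tsum_normWeight_sq hs x
  have h0 : (∑' e : (zdGraph 2).edgeSet, 2 * (deriv (fun s : ℝ => normWeight s x e) σ * normWeight σ x e)) = 0 :=
    hderiv.unique hconst
  rw [tsum_mul_left, mul_eq_zero] at h0
  rcases h0 with h | h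
  · norm_num at h
  · exact h
where
  /-- summability of the squares (they sum to `1 ≠ 0`, so the series is not junk). -/
  summable_of_sum_eq_one {σ : ℝ} (hσ : 0 < σ) (x : ℂ) :
      Summable fun e : (zdGraph 2).edgeSet => normWeight σ x e ^ 2 := by
    by_contra h
    have := tsum_eq_zero_of_not_summable h
    rw [pg_tsum_normWeight_sq hσ x] at this
    exact one_ne_zero this


/-- **The drift is an off-diagonal (pair) sum**: for `σ > 0`,
`plackettDrift I A η σ = ∑_i ∑_{j ≠ i} plackettCoeff σ (m i) (m j) · E[∂_j∂_iΦ_η(X̃^σ)]`. -/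
theorem pg_plackettDrift_eq_offDiag (I : Finset (Sym2 (Site 2))) (A : Set (Set (Sym2 (Site 2))))
    (η : ℝ) {σ : ℝ} (hσ : 0 < σ) :
    plackettDrift I A η σ = ∑ i : I, ∑ j ∈ Finset.univ.erase i,
      plackettCoeff σ (medialPoint 1 i.1) (medialPoint 1 j.1) *
        ∫ ξ, fderiv ℝ (fun y : I → ℝ => fderiv ℝ (regIndicator I A η) y (Pi.single i 1))
          (fun i' : I => normNoise σ ξ (medialPoint 1 i'.1)) (Pi.single j 1) ∂latticeWhiteNoise := by
  unfold plackettDrift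
  refine Finset.sum_congr rfl fun i _ => ?_
  rw [← Finset.add_sum_erase _ _ (Finset.mem_univ i), pg_plackettCoeff_self hσ, zero_mul, zero_add]

/-- **Pure pair functional (registered form).** For `σ > 0`: every diagonal Plackett coefficient
vanishes and the exact drift `plackettDrift I A η σ` is the sum over ordered PAIRS `i ≠ j` of inner
edges. Fully qualified one-line statement registered as a sub-goal stub of the crux item. -/
theorem pl_plackettDrift_offDiag : ∀ (I : Finset (Sym2 (Literature.Probability.LatticeModels.Site 2))) (A : Set (Set (Sym2 (Literature.Probability.LatticeModels.Site 2)))) (η σ : ℝ), 0 < σ → (∀ x : ℂ, Summit.CriticalPhenomena.CardyFormulaZ2.Cruxes.DriftBound.Birth.plackettCoeff σ x x = 0) ∧ Summit.CriticalPhenomena.CardyFormulaZ2.Cruxes.DriftBound.Birth.plackettDrift I A η σ = ∑ i : I, ∑ j ∈ Finset.univ.erase i, Summit.CriticalPhenomena.CardyFormulaZ2.Cruxes.DriftBound.Birth.plackettCoeff σ (Literature.Probability.LatticeModels.medialPoint 1 i.1) (Literature.Probability.LatticeModels.medialPoint 1 j.1) * MeasureTheory.integral Literature.Probability.Percolation.latticeWhiteNoise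 (fun ξ : (Literature.Probability.LatticeModels.zdGraph 2).edgeSet → ℝ => fderiv ℝ (fun y : I → ℝ => fderiv ℝ (Summit.CriticalPhenomena.CardyFormulaZ2.Cruxes.DriftBound.Birth.regIndicator I A η) y (Pi.single i 1)) (fun i' : I => Summit.CriticalPhenomena.CardyFormulaZ2.Cruxes.DriftBound.Birth.normNoise σ ξ (Literature.Probability.LatticeModels.medialPoint 1 i'.1)) (Pi.single j 1)) := by
  intro I A η σ hσ
  exact ⟨fun x => pg_plackettCoeff_self hσ x, pg_plackettDrift_eq_offDiag I A η hσ⟩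

end Summit.CriticalPhenomena.CardyFormulaZ2.Cruxes.DriftBound.Birth

end
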